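import Mathlib.LinearAlgebra.Matrix.NonsingularInverse
import Mathlib.Algebra.Ring.GeomSum
import Mathlib.Analysis.SpecialFunctions.Pow.Real
import HarnessLib

/-!
# `RigorousRGSmallParameter` (Slade, Theorem 1.4.1): the inverse of `c(1 + N)` for a graded-nilpotent
# matrix by the finite Neumann series, with weighted entry bounds ([BS-rg-loc] §2.2, (e:Ainv)–(e:Ainvbd))

Companion ("proof architecture") file of
`Literature/Barriers/CriticalPhenomena/RigorousRGSmallParameter.lean` (Loc norm-estimates layer,
towards [BS-rg-loc] Proposition 1.4.5). In the proof of Propositions 1.4.5/1.5.1 ([BS-rg-loc] §2.2),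
with `A = |X|^{-1}B` (tree: `…LocOperator.Bmat`, block-triangular in the dimension with `|X|` on the
diagonal): "It therefore suffices to show that `|A^{-1}_{m'm}| ≤ C̄𝔥^{m'}R^{-|α(m')|₁}R^{|α(m)|₁}𝔥^{-m}`
(e:Ainvbd). The matrix elements `A^{-1}_{m',m}` can be computed using the formula
`A^{-1} = (I + (A-I))^{-1} = Σ_{j=0}^{|𝔳_+|-1}(-1)^j(A-I)^j` (e:Ainv), where we have used the fact
that the upper triangular matrix `A-I` with zero diagonal is nilpotent. Consequently `A^{-1}_{m',m}`
is bounded by a sum of products of factors of the form `|X|^{-1}|⟨P̂_{m'}(X),f_m^{(a)}⟩_0| ≤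
‖P̂_{m',0}‖_{T_0}‖f_m^{(a)}‖_{Φ(X̂)}` … The product of these factors … is equal to a `j`-dependent
constant". This file PROVES the abstract linear algebra: for a real matrix `N` with
`N i j ≠ 0 ⇒ f i < f j` (graded-nilpotent), `N^{sup f+1} = 0`, `(c(1+N))^{-1} = c^{-1}Σ_{k}(-N)^k`,
and weighted bounds `|N i j| ≤ K₀w_i/w_j` propagate: `|(c(1+N))^{-1}_{ij}| ≤
|c|^{-1}(Σ_k(|ι|K₀)^k)w_i/w_j`. All PROVED, 0 sorry:

* `pow_apply_eq_zero_of_lt`, **`pow_eq_zero`**, `neumann`, `neumann_mul`, `mul_neumann`,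
  **`inv_eq_neumann`**, **`abs_pow_apply_le`**, `abs_neumann_apply_le`, **`abs_inv_apply_le`**.

Sources: D. C. Brydges, G. Slade, *A renormalisation group method. II. Approximation by local
polynomials*, J. Stat. Phys. 159 (2015) 461–491, arXiv:1403.7253, §2.2 (proof of Propositions
(prop:Locbd)/(prop:LTsymXYbd), displays (e:Ainv), (e:Ainvbd)), TeX-source numbering.

## References

* [BrydgesSlade2015RGII] D. C. Brydges, G. Slade, *A renormalisation group method. II.
  Approximation by local polynomials*, J. Stat. Phys. **159** (2015) 461–491, arXiv:1403.7253.
-/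

noncomputable section

namespace Literature.Barriers.CriticalPhenomena

namespace LongRangePhi4

namespace GradedNilpotent

open Finset Matrix

variable {ι : Type*} [Fintype ι] [DecidableEq ι]

/-- **Powers of a graded-nilpotent matrix climb the grading**: if `N i j ≠ 0 ⇒ f i < f j` then
`(N^k) i j ≠ 0 ⇒ f i + k ≤ f j`. [folklore] -/
theorem pow_apply_eq_zero_of_lt {N : Matrix ι ι ℝ} {f : ι → ℕ} (hN : ∀ i j, N i j ≠ 0 → f i < f j) :
    ∀ (k : ℕ) (i j : ι), f j < f i + k → (N ^ k) i j = 0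
  | 0, i, j, h => by
      rw [pow_zero, Matrix.one_apply]
      split_ifs with hij
      · subst hij; omega
      · rfl
  | k + 1, i, j, h => by
      rw [pow_succ, Matrix.mul_apply]
      refine Finset.sum_eq_zero fun l _ => ?_
      by_cases h1 : f l < f i + k
      · rw [pow_apply_eq_zero_of_lt hN k i l h1, zero_mul]
      · by_cases h2 : N l j = 0
        · rw [h2, mul_zero]
        · have := hN l j h2; omega

/-- **Nilpotency**: `N^K = 0` for `K = sup f + 1`. [folklore] -/
theorem pow_eq_zero {N : Matrix ι ι ℝ} {f : ι → ℕ} (hN : ∀ i j, N i j ≠ 0 → f i < f j) :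
    N ^ (univ.sup f + 1) = 0 := by
  ext i j
  rw [Matrix.zero_apply]
  refine pow_apply_eq_zero_of_lt hN _ i j ?_
  have : f j ≤ univ.sup f := Finset.le_sup (Finset.mem_univ j)
  omega

/-- The finite Neumann series `S = Σ_{k<K} (-N)^k`. [folklore] -/
def neumann (N : Matrix ι ι ℝ) (K : ℕ) : Matrix ι ι ℝ := ∑ k ∈ range K, (-N) ^ k

/-- **`S(1 + N) = 1`** when `N^K = 0`, `K ≥ 1` (geometric sum). [folklore] -/
theorem neumann_mul {N : Matrix ι ι ℝ} {K : ℕ} (hK : N ^ K = 0) : neumann N K * (1 + N) = 1 := by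
  have h := geom_sum_mul (-N) K
  have hnK : (-N) ^ K = 0 := by rw [neg_pow, hK, mul_zero]
  rw [hnK, zero_sub] at h
  unfold neumann
  have e : (1 + N : Matrix ι ι ℝ) = -(-N - 1) := by abel
  rw [e, Matrix.mul_neg, h, neg_neg]

/-- **`(1 + N)S = 1`** likewise. [folklore] -/
theorem mul_neumann {N : Matrix ι ι ℝ} {K : ℕ} (hK : N ^ K = 0) : (1 + N) * neumann N K = 1 :=
  mul_eq_one_comm.1 (neumann_mul hK)

/-- **The inverse of `c(1 + N)`** is `c⁻¹ S`. [cite: BrydgesSlade2015RGII, §2.2 (display (e:Ainv): A^{-1} = Σ_j (-1)^j (A-I)^j)] -/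
theorem inv_eq_neumann {N : Matrix ι ι ℝ} {K : ℕ} (hK : N ^ K = 0) {c : ℝ} (hc : c ≠ 0) :
    (c • (1 + N))⁻¹ = c⁻¹ • neumann N K := by
  refine Matrix.inv_eq_left_inv ?_
  rw [Matrix.smul_mul, Matrix.mul_smul, neumann_mul hK, smul_smul, inv_mul_cancel₀ hc, one_smul]

/-- **Weighted entry bounds propagate to powers**: `|N i j| ≤ K₀ w_i/w_j` (`w > 0`) gives
`|(N^k) i j| ≤ (|ι| K₀)^k w_i/w_j`. [folklore] -/
theorem abs_pow_apply_le {N : Matrix ι ι ℝ} {K₀ : ℝ} (hK₀ : 0 ≤ K₀) {w : ι → ℝ} (hw : ∀ i, 0 < w i)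
    (hN : ∀ i j, |N i j| ≤ K₀ * w i / w j) :
    ∀ (k : ℕ) (i j : ι), |(N ^ k) i j| ≤ (Fintype.card ι * K₀) ^ k * w i / w j
  | 0, i, j => by
      rw [pow_zero, pow_zero, Matrix.one_apply, one_mul]
      split_ifs with h
      · subst h; rw [abs_one, div_self (hw i).ne']
      · rw [abs_zero]; exact div_nonneg (hw i).le (hw j).le
  | k + 1, i, j => by
      rw [pow_succ, Matrix.mul_apply]
      calc |∑ l, (N ^ k) i l * N l j| ≤ ∑ l, |(N ^ k) i l| * |N l j| := by
            refine (Finset.abs_sum_le_sum_abs _ _).trans (le_of_eq (Finset.sum_congr rfl fun l _ => abs_mul _ _))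
        _ ≤ ∑ l : ι, ((Fintype.card ι * K₀) ^ k * w i / w l) * (K₀ * w l / w j) :=
            Finset.sum_le_sum fun l _ => mul_le_mul (abs_pow_apply_le hK₀ hw hN k i l) (hN l j) (abs_nonneg _)
              (by have := hw i; have := hw l; positivity)
        _ = ∑ _l : ι, (Fintype.card ι * K₀) ^ k * K₀ * w i / w j := by
            refine Finset.sum_congr rfl fun l _ => ?_
            have := (hw l).ne'
            field_simp
        _ = (Fintype.card ι * K₀) ^ (k + 1) * w i / w j := by
            rw [Finset.sum_const, Finset.card_univ, nsmul_eq_mul, pow_succ]; ring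

/-- Entry bound for the Neumann series. [folklore] -/
theorem abs_neumann_apply_le {N : Matrix ι ι ℝ} {K₀ : ℝ} (hK₀ : 0 ≤ K₀) {w : ι → ℝ} (hw : ∀ i, 0 < w i)
    (hN : ∀ i j, |N i j| ≤ K₀ * w i / w j) (K : ℕ) (i j : ι) :
    |neumann N K i j| ≤ (∑ k ∈ range K, (Fintype.card ι * K₀) ^ k) * w i / w j := by
  unfold neumann
  rw [Matrix.sum_apply]
  simp only [div_eq_mul_inv, Finset.sum_mul]
  refine (Finset.abs_sum_le_sum_abs _ _).trans (Finset.sum_le_sum fun k _ => ?_)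
  have h := abs_pow_apply_le hK₀ hw hN k i j
  have e : |((-N) ^ k) i j| = |(N ^ k) i j| := by
    rcases Nat.even_or_odd k with hk | hk
    · rw [hk.neg_pow]
    · rw [hk.neg_pow, Matrix.neg_apply, abs_neg]
  rw [e]
  simpa only [div_eq_mul_inv] using h

/-- **Weighted bound for the inverse of `c(1+N)`**: `|B^{-1}_{ij}| ≤ |c|^{-1}(Σ_{k<K}(|ι|K₀)^k) w_i/w_j`
("`|A^{-1}_{m'm}| ≤ C̄ 𝔥^{m'}R^{-|α(m')|}R^{|α(m)|}𝔥^{-m}`", (e:Ainvbd)). [cite: BrydgesSlade2015RGII, §2.2 (display (e:Ainvbd) and its derivation)] -/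
theorem abs_inv_apply_le {N : Matrix ι ι ℝ} {f : ι → ℕ} (hNf : ∀ i j, N i j ≠ 0 → f i < f j)
    {K₀ : ℝ} (hK₀ : 0 ≤ K₀) {w : ι → ℝ} (hw : ∀ i, 0 < w i) (hN : ∀ i j, |N i j| ≤ K₀ * w i / w j)
    {c : ℝ} (hc : c ≠ 0) (i j : ι) :
    |(c • (1 + N))⁻¹ i j| ≤ |c|⁻¹ * (∑ k ∈ range (univ.sup f + 1), (Fintype.card ι * K₀) ^ k) * w i / w j := by
  rw [inv_eq_neumann (pow_eq_zero hNf) hc, Matrix.smul_apply, smul_eq_mul, abs_mul, abs_inv, mul_assoc, mul_div_assoc]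
  refine mul_le_mul_of_nonneg_left ?_ (by positivity)
  have h := abs_neumann_apply_le hK₀ hw hN (univ.sup f + 1) i j
  simpa only [mul_div_assoc] using h

end GradedNilpotent

end LongRangePhi4

end Literature.Barriers.CriticalPhenomena
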